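import Summits.QuantumFields.YangMills.Theorems.BalabanUVNodesK0RecordFormatNamesP0C

/-!
# NODE O port PT-A — `stub_G3C` helper: the (1.19)-type INVARIANCE of the resolvent trace of the record carrier's non-`b₀` block from the P0-ℂ body's
# PIECEWISE COVARIANCE (P3) — `Tr (x·1 + T_n(u·φ))⁻¹ = Tr (x·1 + T_n(φ))⁻¹` for every units-valued `u`, every pair `φ`, every `x` (row (g6) for the TOTAL of
# `G3CPiecesAt`; the generic block-diagonal-conjugation lemmas are the tool for the termwise (g6) of any walk edition)

Cell `ym-nodeO-ideate`, porter hand `hand-27930-G3C` (g0); proof kind, `--supports stmt-QuantumFields-27930` (count-neutral helper).  [I] = [Balaban1987RG1], [16] = [Balaban1985UV3].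

WHY.  `G3CPiecesAt` (✓`…PortS1G3CDefs`) row (g6) asks the resolvent pieces `EG x n X φ` to be invariant under the (1.10) action `Sect2.cAct u` of every units-valued `u`; their sum
(row (g1)) is `Tr (x·1 + T_n(φ))⁻¹`, `T_n(φ)` = the non-`b₀` block of the total carrier `TC n φ = Σ_Y TY n Y φ`.  The P0-ℂ body `P0CarrierClauses` (✓`…K0RecordFormatNamesP0C`) gives (P3):
`Matrix.of (TY n Y (cAct u φ)) = AdM n u * Matrix.of (TY n Y φ) * (AdM n u)⁻¹` with `AdM n u` INVERTIBLE and BOND-BLOCK-DIAGONAL (`AdM n u i j = 0` for `i.1 ≠ j.1`), for ALL pairs.  Since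
membership in `NonB0Idx` depends on the bond `i.1` only, the conjugation COMMUTES with the restriction to the non-`b₀` block, and the trace of the resolvent is invariant — for every `φ`
(junk included) and every `x`, with no analytic input.  This is the TOTAL's (g6); the §1 lemmas (conjugation by a matrix commuting with a coordinate projection passes to the block, to
products, to `Matrix.inv`) are what a walk edition uses termwise.

WHAT THIS FILE PROVES (sorry-free; elementary matrix algebra + one `obtain` on the body):
* §1 `G3CInv.*` — for a predicate `p` on a finite index type and a matrix `A` whose OFF-BLOCKS vanish (`A i j = 0` unless `p i ↔ p j`): `(A * B)|_p = A|_p * B|_p` and `(B * A)|_p = B|_p * A|_p`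
  (`submatrix_mul_of_offblock_left∕_right`), `A|_p * A⁻¹|_p = 1`, `(A⁻¹)|_p = (A|_p)⁻¹` and `IsUnit (A|_p).det` for `IsUnit A.det` (`submatrix_mul_submatrix_inv`, `submatrix_inv_of_offblock`,
  `isUnit_det_submatrix_of_offblock`), `(A * M * A⁻¹)|_p = A|_p * M|_p * (A|_p)⁻¹` (`submatrix_conj_of_offblock`), `(A * M * A⁻¹)⁻¹ = A * M⁻¹ * A⁻¹` (`inv_conj`), and
  `Tr (x·1 + A * M * A⁻¹)⁻¹ = Tr (x·1 + M)⁻¹` (`trace_resolvent_conj`).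
* §2 `trace_resolvent_nonB0_cAct` — under `P0CarrierClauses …`: `∀ n u φ x, Tr (x·1 + of (fun i j : NonB0Idx ↦ TC n (cAct u φ) i.1 j.1))⁻¹ = Tr (x·1 + of (fun i j : NonB0Idx ↦ TC n φ i.1 j.1))⁻¹`,
  and the matrix identity behind it `of (TC n (cAct u φ))|_{NonB0} = AdM|_{NonB0} * of (TC n φ)|_{NonB0} * (AdM|_{NonB0})⁻¹` (`nonB0_block_cAct`).

HONEST FRAMING.  A count-neutral algebraic helper; `stub_G3C` is NOT closed by it (the hand's verdict on the cut stands: `G3C-OBSTRUCTION-v1.md`); nothing of Bałaban's estimates asserted,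
ported or discharged; `P0CarrierClauses` is a HYPOTHESIS here (inhabited nowhere); 27930 OPEN; NODE O 0∕1; COUNT 8∕28 · K 1∕4 UNMOVED; finite `𝕋⁴` at fixed ε — NOT continuum ∕ OS ∕ Clay;
**the Yang–Mills mass gap is NOT proved by any of this.**  No `sorry`, no `instance`, no `notation`; standard axioms.
-/

noncomputable section

open scoped BigOperators Matrix.Norms.L2Operator Topology
open Filter

namespace Summit.QuantumFields.YangMills.Theorems.BalabanUVNodesPortS1

/-! ## §1  Conjugation by a matrix commuting with a coordinate projection: blocks, products, inverses, resolvent traces -/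

namespace G3CInv

variable {ι : Type*} [Fintype ι] [DecidableEq ι] {R : Type*} [CommRing R]

omit [DecidableEq ι] in
/-- **Block of a product, left factor with vanishing `p → ¬p` off-block**: `(A * B)|_p = A|_p * B|_p`. [folklore] -/
theorem submatrix_mul_of_offblock_left {p : ι → Prop} [DecidablePred p] {A : Matrix ι ι R} (hA : ∀ i k, p i → ¬ p k → A i k = 0)
    (B : Matrix ι ι R) :
    (A * B).submatrix (Subtype.val : {i // p i} → ι) (Subtype.val : {i // p i} → ι) =
      A.submatrix (Subtype.val : {i // p i} → ι) (Subtype.val : {i // p i} → ι) *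
        B.submatrix (Subtype.val : {i // p i} → ι) (Subtype.val : {i // p i} → ι) := by
  ext i j
  simp only [Matrix.submatrix_apply, Matrix.mul_apply]
  rw [← Fintype.sum_subtype_add_sum_subtype p (fun k => A i.1 k * B k j.1)]
  have h0 : ∑ k : {k // ¬ p k}, A i.1 k * B k j.1 = 0 :=
    Finset.sum_eq_zero fun k _ => by rw [hA i.1 k.1 i.2 k.2, zero_mul]
  rw [h0, add_zero]

omit [DecidableEq ι] in
/-- **Block of a product, right factor with vanishing `¬p → p` off-block**: `(B * A)|_p = B|_p * A|_p`. [folklore] -/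
theorem submatrix_mul_of_offblock_right {p : ι → Prop} [DecidablePred p] {A : Matrix ι ι R} (hA : ∀ k j, ¬ p k → p j → A k j = 0)
    (B : Matrix ι ι R) :
    (B * A).submatrix (Subtype.val : {i // p i} → ι) (Subtype.val : {i // p i} → ι) =
      B.submatrix (Subtype.val : {i // p i} → ι) (Subtype.val : {i // p i} → ι) *
        A.submatrix (Subtype.val : {i // p i} → ι) (Subtype.val : {i // p i} → ι) := by
  ext i j
  simp only [Matrix.submatrix_apply, Matrix.mul_apply]
  rw [← Fintype.sum_subtype_add_sum_subtype p (fun k => B i.1 k * A k j.1)]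
  have h0 : ∑ k : {k // ¬ p k}, B i.1 k * A k j.1 = 0 :=
    Finset.sum_eq_zero fun k _ => by rw [hA k.1 j.1 k.2 j.2, mul_zero]
  rw [h0, add_zero]

omit [Fintype ι] in
/-- The identity block is the identity. [folklore] -/
theorem submatrix_one_val (p : ι → Prop) :
    (1 : Matrix ι ι R).submatrix (Subtype.val : {i // p i} → ι) (Subtype.val : {i // p i} → ι) = 1 := by
  ext i j
  simp only [Matrix.submatrix_apply, Matrix.one_apply, Subtype.val_inj]

/-- The `p`-block of a unit with vanishing `p → ¬p` off-block is a unit, with right inverse the block of the inverse. [folklore] -/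
theorem submatrix_mul_submatrix_inv {p : ι → Prop} [DecidablePred p] {A : Matrix ι ι R} (hA : ∀ i k, p i → ¬ p k → A i k = 0)
    (hU : IsUnit A.det) :
    A.submatrix (Subtype.val : {i // p i} → ι) (Subtype.val : {i // p i} → ι) *
        (A⁻¹).submatrix (Subtype.val : {i // p i} → ι) (Subtype.val : {i // p i} → ι) = 1 := by
  rw [← submatrix_mul_of_offblock_left hA, Matrix.mul_nonsing_inv _ hU, submatrix_one_val]

/-- **Block of the inverse = inverse of the block** for a unit with vanishing `p → ¬p` off-block. [folklore] -/
theorem submatrix_inv_of_offblock {p : ι → Prop} [DecidablePred p] {A : Matrix ι ι R} (hA : ∀ i k, p i → ¬ p k → A i k = 0)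
    (hU : IsUnit A.det) :
    (A⁻¹).submatrix (Subtype.val : {i // p i} → ι) (Subtype.val : {i // p i} → ι) =
      (A.submatrix (Subtype.val : {i // p i} → ι) (Subtype.val : {i // p i} → ι))⁻¹ :=
  (Matrix.inv_eq_right_inv (submatrix_mul_submatrix_inv hA hU)).symm

/-- The `p`-block of such a unit has unit determinant. [folklore] -/
theorem isUnit_det_submatrix_of_offblock {p : ι → Prop} [DecidablePred p] {A : Matrix ι ι R} (hA : ∀ i k, p i → ¬ p k → A i k = 0)
    (hU : IsUnit A.det) : IsUnit (A.submatrix (Subtype.val : {i // p i} → ι) (Subtype.val : {i // p i} → ι)).det := by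
  have h := congrArg Matrix.det (submatrix_mul_submatrix_inv hA hU)
  rw [Matrix.det_mul, Matrix.det_one] at h
  exact isUnit_iff_exists_inv.2 ⟨_, h⟩

/-- **Block of a conjugate**: `(A * M * A⁻¹)|_p = A|_p * M|_p * (A|_p)⁻¹` for a unit `A` whose two off-blocks vanish. [folklore] -/
theorem submatrix_conj_of_offblock {p : ι → Prop} [DecidablePred p] {A : Matrix ι ι R} (hA : ∀ i j, ¬ (p i ↔ p j) → A i j = 0)
    (hU : IsUnit A.det) (M : Matrix ι ι R) :
    (A * M * A⁻¹).submatrix (Subtype.val : {i // p i} → ι) (Subtype.val : {i // p i} → ι) =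
      A.submatrix (Subtype.val : {i // p i} → ι) (Subtype.val : {i // p i} → ι) *
        M.submatrix (Subtype.val : {i // p i} → ι) (Subtype.val : {i // p i} → ι) *
        (A.submatrix (Subtype.val : {i // p i} → ι) (Subtype.val : {i // p i} → ι))⁻¹ := by
  have hL : ∀ i k, p i → ¬ p k → A i k = 0 := fun i k hi hk => hA i k (by tauto)
  have hR : ∀ k j, ¬ p k → p j → A k j = 0 := fun k j hk hj => hA k j (by tauto)
  have hAS := submatrix_mul_submatrix_inv hL hU
  rw [← submatrix_inv_of_offblock hL hU]
  calc (A * M * A⁻¹).submatrix (Subtype.val : {i // p i} → ι) (Subtype.val : {i // p i} → ι)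
      = (A * M * A⁻¹).submatrix (Subtype.val : {i // p i} → ι) (Subtype.val : {i // p i} → ι) *
          (A.submatrix (Subtype.val : {i // p i} → ι) (Subtype.val : {i // p i} → ι) *
            (A⁻¹).submatrix (Subtype.val : {i // p i} → ι) (Subtype.val : {i // p i} → ι)) := by rw [hAS, Matrix.mul_one]
    _ = (A * M * A⁻¹ * A).submatrix (Subtype.val : {i // p i} → ι) (Subtype.val : {i // p i} → ι) *
          (A⁻¹).submatrix (Subtype.val : {i // p i} → ι) (Subtype.val : {i // p i} → ι) := by
        rw [← Matrix.mul_assoc, submatrix_mul_of_offblock_right hR]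
    _ = (A * M).submatrix (Subtype.val : {i // p i} → ι) (Subtype.val : {i // p i} → ι) *
          (A⁻¹).submatrix (Subtype.val : {i // p i} → ι) (Subtype.val : {i // p i} → ι) := by
        rw [Matrix.mul_assoc (A * M), Matrix.nonsing_inv_mul _ hU, Matrix.mul_one]
    _ = _ := by rw [submatrix_mul_of_offblock_left hL]

omit [DecidableEq ι] in
/-- **Inverse of a conjugate**: `(A * M * A⁻¹)⁻¹ = A * M⁻¹ * A⁻¹` for `IsUnit A.det` (Mathlib's `Matrix.inv` on both sides; if `M` is not a unit both sides are `0`). [folklore] -/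
theorem inv_conj [DecidableEq ι] {A : Matrix ι ι R} (hA : IsUnit A.det) (M : Matrix ι ι R) :
    (A * M * A⁻¹)⁻¹ = A * M⁻¹ * A⁻¹ := by
  by_cases hM : IsUnit M.det
  · apply Matrix.inv_eq_right_inv
    calc A * M * A⁻¹ * (A * M⁻¹ * A⁻¹) = A * M * (A⁻¹ * A) * M⁻¹ * A⁻¹ := by simp only [Matrix.mul_assoc]
      _ = 1 := by rw [Matrix.nonsing_inv_mul _ hA, Matrix.mul_one, Matrix.mul_assoc A, Matrix.mul_nonsing_inv _ hM,
          Matrix.mul_one, Matrix.mul_nonsing_inv _ hA]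
  · have hA' : IsUnit A := (Matrix.isUnit_iff_isUnit_det A).2 hA
    have hc : ¬ IsUnit (A * M * A⁻¹).det := by rwa [Matrix.det_conj hA']
    rw [Matrix.nonsing_inv_apply_not_isUnit _ hc, Matrix.nonsing_inv_apply_not_isUnit _ hM, Matrix.mul_zero,
      Matrix.zero_mul]

omit [DecidableEq ι] in
/-- **The resolvent trace is conjugation-invariant**: `Tr (x·1 + A * M * A⁻¹)⁻¹ = Tr (x·1 + M)⁻¹` for `IsUnit A.det`. [folklore] -/
theorem trace_resolvent_conj [DecidableEq ι] {A : Matrix ι ι R} (hA : IsUnit A.det) (M : Matrix ι ι R) (x : R) :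
    (x • (1 : Matrix ι ι R) + A * M * A⁻¹)⁻¹.trace = (x • (1 : Matrix ι ι R) + M)⁻¹.trace := by
  have e : x • (1 : Matrix ι ι R) + A * M * A⁻¹ = A * (x • (1 : Matrix ι ι R) + M) * A⁻¹ := by
    rw [Matrix.mul_add, Matrix.add_mul, Matrix.mul_smul, Matrix.mul_one, Matrix.smul_mul, Matrix.mul_nonsing_inv _ hA]
  rw [e, inv_conj hA, Matrix.trace_mul_cycle, Matrix.nonsing_inv_mul _ hA, Matrix.one_mul]

end G3CInv

/-! ## §2  At the record: the non-`b₀` block of the carrier under the (1.10) action, and the invariance of its resolvent trace -/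

open Summit.QuantumFields.YangMills.Theorems.K0RecordFormatNames
open Literature.MathematicalPhysics.QuantumFieldTheory.Balaban1983to89
open Literature.MathematicalPhysics.QuantumFieldTheory.Balaban1983to89.Node00
open Literature.MathematicalPhysics.QuantumFieldTheory.Balaban1983to89.T4Continuum (T4Family)

variable (F : T4Family)

/-- **THE NON-`b₀` BLOCK OF THE TOTAL CARRIER UNDER THE (1.10) ACTION** (from (P3) piecewise covariance + (P4) `TC = Σ_Y TY`): for every units-valued `u` and EVERY pair `φ`,
`of (TC n (cAct u φ))|_{NonB0} = AdM|_{NonB0} * of (TC n φ)|_{NonB0} * (AdM|_{NonB0})⁻¹`, with `AdM|_{NonB0}` a unit — the bond-block-diagonal `AdM n u` commutes with the restriction to the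
non-`b₀` bonds. [cite: Balaban1987RG1, (1.10) p.262, (1.19) p.263, (2.11) p.267] -/
theorem nonB0_block_cAct {a₀ δ₀ c₀ γ₀ γ₁ : ℝ} {Mc : ℕ} {α₀ α₁ ε₂₉ : ℝ} {k : ℕ} {TC TY TZY AdM AdZ}
    (hP : P0CarrierClauses F a₀ δ₀ c₀ γ₀ γ₁ Mc α₀ α₁ ε₂₉ k TC TY TZY AdM AdZ) (n : ℕ)
    (u : Site (F.P (recordK₀ F Mc k + n)) 0 → (MatA 2)ˣ) (φ : Sect2.CPair (F.P (recordK₀ F Mc k + n)) (MatA 2)) :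
    IsUnit ((AdM n u).submatrix (Subtype.val : NonB0Idx F k (recordK₀ F Mc k + n) → FluctIdx F k (recordK₀ F Mc k + n)) Subtype.val).det ∧
    Matrix.of (fun i j : NonB0Idx F k (recordK₀ F Mc k + n) => TC n (Sect2.cAct u φ) i.1 j.1) =
      (AdM n u).submatrix (Subtype.val : NonB0Idx F k (recordK₀ F Mc k + n) → _) Subtype.val *
        Matrix.of (fun i j : NonB0Idx F k (recordK₀ F Mc k + n) => TC n φ i.1 j.1) *
        ((AdM n u).submatrix (Subtype.val : NonB0Idx F k (recordK₀ F Mc k + n) → _) Subtype.val)⁻¹ := by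
  obtain ⟨-, -, -, -, -, -, hP3, hSum, -⟩ := hP
  obtain ⟨hU, hBlk, hCov⟩ := hP3 n u
  -- the total carrier as a matrix is the sum of its pieces, hence covariant with the same `AdM`
  have hTot : ∀ ψ : Sect2.CPair (F.P (recordK₀ F Mc k + n)) (MatA 2),
      Matrix.of (TC n ψ) = ∑ Y : (recordDomSys F Mc k (recordK₀ F Mc k + n)).Dom, Matrix.of (TY n Y ψ) := by
    intro ψ
    ext i j
    rw [Matrix.of_apply, hSum n ψ i j, Matrix.sum_apply]
    rfl
  have hCovTot : Matrix.of (TC n (Sect2.cAct u φ)) = AdM n u * Matrix.of (TC n φ) * (AdM n u)⁻¹ := by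
    rw [hTot, hTot, Finset.mul_sum, Finset.sum_mul]
    exact Finset.sum_congr rfl fun Y _ => hCov Y φ
  -- `AdM n u` has vanishing off-blocks for the non-`b₀` predicate (membership depends on the bond only)
  have hdet : IsUnit (AdM n u).det := (Matrix.isUnit_iff_isUnit_det _).1 hU
  have hoff : ∀ i j : FluctIdx F k (recordK₀ F Mc k + n),
      ¬ ((i.1 ∉ Set.range (recordB0 F k (recordK₀ F Mc k + n))) ↔ (j.1 ∉ Set.range (recordB0 F k (recordK₀ F Mc k + n)))) →
        AdM n u i j = 0 := by
    intro i j hij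
    apply hBlk i j
    intro hb
    apply hij
    rw [hb]
  refine ⟨G3CInv.isUnit_det_submatrix_of_offblock (fun i j hi hj => hoff i j (by tauto)) hdet, ?_⟩
  have e1 : Matrix.of (fun i j : NonB0Idx F k (recordK₀ F Mc k + n) => TC n (Sect2.cAct u φ) i.1 j.1) =
      (Matrix.of (TC n (Sect2.cAct u φ))).submatrix (Subtype.val : NonB0Idx F k (recordK₀ F Mc k + n) → _)
        (Subtype.val : NonB0Idx F k (recordK₀ F Mc k + n) → _) := rfl
  have e2 : Matrix.of (fun i j : NonB0Idx F k (recordK₀ F Mc k + n) => TC n φ i.1 j.1) =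
      (Matrix.of (TC n φ)).submatrix (Subtype.val : NonB0Idx F k (recordK₀ F Mc k + n) → _)
        (Subtype.val : NonB0Idx F k (recordK₀ F Mc k + n) → _) := rfl
  rw [e1, e2, hCovTot, G3CInv.submatrix_conj_of_offblock hoff hdet]

/-- ★ **(g6) FOR THE TOTAL — INVARIANCE OF THE RESOLVENT TRACE OF THE NON-`b₀` BLOCK**: under the P0-ℂ body, for every volume `n`, every units-valued `u`, EVERY pair `φ` and every
`x`, `Tr (x·1 + T_n(u·φ))⁻¹ = Tr (x·1 + T_n(φ))⁻¹` — the sum of the `G3CPiecesAt` pieces (row (g1)) is invariant under the (1.10) action, with no analytic input ([I] (1.19) «for all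
Gᶜ-valued gauge transformations»; [16] p.272 «gauge invariant, localized expressions»). [cite: Balaban1987RG1, (1.19) p.263, (1.10) p.262; Balaban1985UV3, (63) p.272] -/
theorem trace_resolvent_nonB0_cAct {a₀ δ₀ c₀ γ₀ γ₁ : ℝ} {Mc : ℕ} {α₀ α₁ ε₂₉ : ℝ} {k : ℕ} {TC TY TZY AdM AdZ}
    (hP : P0CarrierClauses F a₀ δ₀ c₀ γ₀ γ₁ Mc α₀ α₁ ε₂₉ k TC TY TZY AdM AdZ) (n : ℕ)
    (u : Site (F.P (recordK₀ F Mc k + n)) 0 → (MatA 2)ˣ) (φ : Sect2.CPair (F.P (recordK₀ F Mc k + n)) (MatA 2)) (x : ℂ) :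
    (x • (1 : Matrix (NonB0Idx F k (recordK₀ F Mc k + n)) (NonB0Idx F k (recordK₀ F Mc k + n)) ℂ) +
        Matrix.of (fun i j : NonB0Idx F k (recordK₀ F Mc k + n) => TC n (Sect2.cAct u φ) i.1 j.1))⁻¹.trace =
      (x • (1 : Matrix (NonB0Idx F k (recordK₀ F Mc k + n)) (NonB0Idx F k (recordK₀ F Mc k + n)) ℂ) +
        Matrix.of (fun i j : NonB0Idx F k (recordK₀ F Mc k + n) => TC n φ i.1 j.1))⁻¹.trace := by
  obtain ⟨hU, hEq⟩ := nonB0_block_cAct F hP n u φ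
  rw [hEq]
  exact G3CInv.trace_resolvent_conj hU _ x

end Summit.QuantumFields.YangMills.Theorems.BalabanUVNodesPortS1

end
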